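import Summits.CriticalPhenomena.PercolationContinuityZ3.Theorems.PercAnnulusCrossingHarrisSlackLogarithmic
import Summits.CriticalPhenomena.PercolationContinuityZ3.Theorems.PercAnnulusCrossingHarrisSlackBoxCross
import HarnessLib

/-!
# RSW3 lane (lead, gen 25): QUANTITATIVE HARRIS WITH LOGARITHMIC LOSS, III — the lattice cube of `Λ(N) ⊆ ℤ^d` (every `d`, `N`, `p`):
# `P_p(A ∩ B) − P_p(A)P_p(B) ≥ W/(40·log² max(e², 1/(4W)))`, `W = p(1−p)·Σ_z P_p(z piv A)·P_p(z piv B)`; Kesten's box crossings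

builds on p205010 (kernel theorem, internal audit signed; external expert review pending) — NOT used in this file (every `d`, every `p`).

Cell `prim-rsw3` (LANE 3), lead seat, gen 25.  Support file (`--supports stmt-CriticalPhenomena-4575`); no definitions, no named facts,
no sorries.  Setting of gen 23's part IV (`…HarrisSlackLattice`: pairs of `Λ(N)` as coordinates `PairIdx d N`, bias `boxBias d N p` = `p` on
lattice edges and `0` elsewhere, events read through `toCube N ω`, the pivotality bridge `P_p(z ∈ E(ℤ^d), z piv A) = E_p[D_z𝟙_A]`) and
part VII (`…HarrisSlackBoxCross`: Kesten's `boxCross L i` as a cube event).  Gen 23's lattice quantitative Harris inequality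
(`lattice_cov_ge_level_one_sub`) had polynomial loss `(r/(p(1−p)))²(P(A)P(B))^{3/4}`; part II of this generation gives logarithmic loss and
needs neither `0 < p < 1` nor hypercontractivity:

* **`lattice_cov_ge_level_one_div_log_sq`** — for ANY two increasing events `A = {P ∘ toCube}`, `B = {Q ∘ toCube}` of the lattice cube of `Λ(N)`
  (every `d`, `N`, every `p ∈ [0,1]`), with the JOINT PIVOTAL WEIGHT `W = p(1−p)·Σ_{z ⊆ Λ(N)} P_p(z ∈ E(ℤ^d), z piv A)·P_p(z ∈ E(ℤ^d), z piv B)`: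
  **`P_p(A ∩ B) − P_p(A)·P_p(B) ≥ W / (40·log²(max(e², 1/(4W))))`** (indicators have `σ_A σ_B ≤ 1/4`).  Read contrapositively: two increasing
  events whose Harris slack is `≤ s` have joint pivotal weight `W ≲ s·log²(1/s)` — Talagrand's "increasing events are positively correlated
  exactly to the extent that they share pivotal coordinates", up to one logarithm, uniformly in `p` and `d`.
* **`lattice_cov_pivotal_sandwich`** — with gen 23's decorrelation bound: `W/(40 log²(max(e²,1/(4W)))) ≤ Cov ≤ p(1−p)Σ_z √(I_z(A)I_z(B))` —
  the Harris slack of two increasing events is squeezed between the `ℓ¹` and the `ℓ^{1/2}` joint pivotal weights (`Cov = 0 ⟺ W = 0`).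
* **`boxCross_cov_ge_level_one_div_log_sq`** — the instance for two crossing directions `A = boxCross L i`, `B = boxCross L j` of a block
  `{0..L} ⊆ Λ(N)` (every `d`; with gen 23's `boxCross_abs_cov_le_pivotal` the Harris slack of two directions is now pinned between
  `W/(40 log²(1/(4W)))` and `p(1−p)Σ_z √(I_z(i)I_z(j))`).
Part IV (`…HarrisSlackLogarithmicGluing`) re-prices the lane's gluing criterion in this currency.

References: A. De, S. Nadimpalli, R. A. Servedio, ITCS 2021 Art. 69 = arXiv:2012.12216 [cite: DeNadimpalliServedio2021, Thm 15 / Thm 41];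
M. Talagrand, Combinatorica 16 (1996) 243–258, Thm 1.1; G. Grimmett, *Percolation* (1999) Thm 2.4, §2.4; H. Kesten (1982) §3.3;
C. Garban, G. Pete, O. Schramm, Acta Math. 205 (2010) §1 (pivotal edges of crossing events).
-/

noncomputable section

namespace Summit.CriticalPhenomena.PercolationContinuityZ3.Theorems.Crossing

open MeasureTheory Finset Function
open Literature.Probability.Percolation Literature.Probability.LatticeModels
open Literature.Probability.ODonnellSaksSchrammServedio2005
open Literature.Probability.ODonnellSaksSchrammServedio2005.Strategy
open Literature.Probability.Percolation.GhostExploration Literature.Probability.Percolation.SeedExploration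
open Literature.Probability.Percolation.OneArmOSSS Literature.Probability.Percolation.DCT16
open Summit.CriticalPhenomena.PercolationContinuityZ3.Theorems.SurfaceTension
open Summit.CriticalPhenomena.PercolationContinuityZ3.Theorems.CrossingRevealment
open Summit.CriticalPhenomena.PercolationContinuityZ3.Theorems.Crossing.Spectral

variable {d : ℕ}

/-! ## §1 Two increasing events of the lattice cube -/

section Lattice

variable (N : ℕ) (p : unitInterval) (P Q : (PairIdx d N → Bool) → Prop) [DecidablePred P] [DecidablePred Q]
  (hP : ∀ e x, P (update x e false) → P (update x e true)) (hQ : ∀ e x, Q (update x e false) → Q (update x e true))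

include hP hQ in
/-- **THE QUANTITATIVE HARRIS INEQUALITY WITH LOGARITHMIC LOSS ON `ℤ^d`** (every `d`, `N`, every `p ∈ [0,1]`; increasing cube events
`A = {P ∘ toCube}`, `B = {Q ∘ toCube}`; `W = p(1−p)·Σ_{z ⊆ Λ(N)} P_p(z ∈ E(ℤ^d), z piv A)·P_p(z ∈ E(ℤ^d), z piv B)` the joint pivotal weight):
**`W / (40·log²(max(e², 1/(4W)))) ≤ P_p(A ∩ B) − P_p(A)·P_p(B)`** (part II `cov_ge_level_one_div_log_sq_of_le` with `σ_Aσ_B ≤ 1/4`, the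
pivotality bridge of gen 23's part IV).  [cite: DeNadimpalliServedio2021, Thm 41 (finite product spaces)] [cite: Talagrand1996, Thm 1.1] -/
theorem lattice_cov_ge_level_one_div_log_sq :
    ((p : ℝ) * (1 - p) * ∑ z ∈ (box d N).sym2,
          (bondPercolation (zdGraph d) p).real {ω | z ∈ (zdGraph d).edgeSet ∧ IsPivotal {ω | P (toCube N ω)} z ω}
            * (bondPercolation (zdGraph d) p).real {ω | z ∈ (zdGraph d).edgeSet ∧ IsPivotal {ω | Q (toCube N ω)} z ω})
        / (40 * Real.log (max (Real.exp 2) (1 / 4 / ((p : ℝ) * (1 - p) * ∑ z ∈ (box d N).sym2,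
          (bondPercolation (zdGraph d) p).real {ω | z ∈ (zdGraph d).edgeSet ∧ IsPivotal {ω | P (toCube N ω)} z ω}
            * (bondPercolation (zdGraph d) p).real {ω | z ∈ (zdGraph d).edgeSet ∧ IsPivotal {ω | Q (toCube N ω)} z ω}))) ^ 2)
      ≤ (bondPercolation (zdGraph d) p).real ({ω | P (toCube N ω)} ∩ {ω | Q (toCube N ω)})
        - (bondPercolation (zdGraph d) p).real {ω | P (toCube N ω)} * (bondPercolation (zdGraph d) p).real {ω | Q (toCube N ω)} := by
  classical
  have hmonoP : ∀ (e : PairIdx d N) (x : PairIdx d N → Bool),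
      (if P (update x e false) then (1 : ℝ) else 0) ≤ (if P (update x e true) then (1 : ℝ) else 0) := by
    intro e x
    by_cases h0 : P (update x e false)
    · rw [if_pos h0, if_pos (hP e x h0)]
    · rw [if_neg h0]; split_ifs <;> norm_num
  have hmonoQ : ∀ (e : PairIdx d N) (x : PairIdx d N → Bool),
      (if Q (update x e false) then (1 : ℝ) else 0) ≤ (if Q (update x e true) then (1 : ℝ) else 0) := by
    intro e x
    by_cases h0 : Q (update x e false)
    · rw [if_pos h0, if_pos (hQ e x h0)]
    · rw [if_neg h0]; split_ifs <;> norm_num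
  -- indicators have `E 𝟙² − (E 𝟙)² ≤ 1/4`, hence `σ_A σ_B ≤ 1/4`
  have hsq : ∀ (R : (PairIdx d N → Bool) → Prop) [DecidablePred R],
      Real.sqrt ((∑ x : PairIdx d N → Bool, wt (boxBias d N p) x * ((if R x then (1 : ℝ) else 0) * (if R x then (1 : ℝ) else 0)))
          - (∑ x : PairIdx d N → Bool, wt (boxBias d N p) x * (if R x then (1 : ℝ) else 0)) ^ 2) ≤ 1 / 2 := by
    intro R _
    have hff : ∑ x : PairIdx d N → Bool, wt (boxBias d N p) x * ((if R x then (1 : ℝ) else 0) * (if R x then (1 : ℝ) else 0))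
        = ∑ x : PairIdx d N → Bool, wt (boxBias d N p) x * (if R x then (1 : ℝ) else 0) := by
      refine Finset.sum_congr rfl fun x _ => ?_
      split_ifs <;> ring
    rw [hff]
    set t : ℝ := ∑ x : PairIdx d N → Bool, wt (boxBias d N p) x * (if R x then (1 : ℝ) else 0)
    have ht : t - t ^ 2 ≤ (1 / 2) ^ 2 := by nlinarith [sq_nonneg (t - 1 / 2)]
    calc Real.sqrt (t - t ^ 2) ≤ Real.sqrt ((1 / 2) ^ 2) := Real.sqrt_le_sqrt ht
      _ = 1 / 2 := Real.sqrt_sq (by norm_num)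
  have hV : Real.sqrt ((∑ x : PairIdx d N → Bool, wt (boxBias d N p) x * ((if P x then (1 : ℝ) else 0) * (if P x then (1 : ℝ) else 0)))
          - (∑ x : PairIdx d N → Bool, wt (boxBias d N p) x * (if P x then (1 : ℝ) else 0)) ^ 2)
        * Real.sqrt ((∑ x : PairIdx d N → Bool, wt (boxBias d N p) x * ((if Q x then (1 : ℝ) else 0) * (if Q x then (1 : ℝ) else 0)))
          - (∑ x : PairIdx d N → Bool, wt (boxBias d N p) x * (if Q x then (1 : ℝ) else 0)) ^ 2) ≤ 1 / 4 := by
    calc _ ≤ (1 / 2 : ℝ) * (1 / 2) := mul_le_mul (hsq P) (hsq Q) (Real.sqrt_nonneg _) (by norm_num)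
      _ = 1 / 4 := by norm_num
  have h := cov_ge_level_one_div_log_sq_of_le (boxBias d N p) (boxBias_nonneg N p.2.1) (boxBias_le_one N p.2.2)
    (fun x => if P x then (1 : ℝ) else 0) (fun x => if Q x then (1 : ℝ) else 0) hmonoP hmonoQ hV
  -- the joint level-1 weight in lattice currency
  have hA : ∑ e : PairIdx d N, boxBias d N p e * (1 - boxBias d N p e)
        * ((∑ x : PairIdx d N → Bool, wt (boxBias d N p) x
            * ((if P (update x e true) then (1 : ℝ) else 0) - (if P (update x e false) then (1 : ℝ) else 0)))
          * (∑ x : PairIdx d N → Bool, wt (boxBias d N p) x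
            * ((if Q (update x e true) then (1 : ℝ) else 0) - (if Q (update x e false) then (1 : ℝ) else 0))))
      = (p : ℝ) * (1 - p) * ∑ z ∈ (box d N).sym2,
          (bondPercolation (zdGraph d) p).real {ω | z ∈ (zdGraph d).edgeSet ∧ IsPivotal {ω | P (toCube N ω)} z ω}
            * (bondPercolation (zdGraph d) p).real {ω | z ∈ (zdGraph d).edgeSet ∧ IsPivotal {ω | Q (toCube N ω)} z ω} := by
    rw [Finset.mul_sum, ← Finset.sum_coe_sort (box d N).sym2]
    refine Finset.sum_congr rfl fun e _ => ?_
    by_cases he : e.1 ∈ (zdGraph d).edgeSet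
    · rw [sum_wt_deriv_indicator_eq N p P hP e, sum_wt_deriv_indicator_eq N p Q hQ e,
        ← real_isPivotal_setOf_toCube N p P hP e he, ← real_isPivotal_setOf_toCube N p Q hQ e he]
      unfold boxBias; rw [if_pos he]
    · have hzP : (bondPercolation (zdGraph d) p).real {ω | e.1 ∈ (zdGraph d).edgeSet ∧ IsPivotal {ω | P (toCube N ω)} e.1 ω} = 0 := by
        have : {ω : BondConfig (Site d) | e.1 ∈ (zdGraph d).edgeSet ∧ IsPivotal {ω | P (toCube N ω)} e.1 ω} = ∅ := by
          ext ω; simp [he]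
        rw [this, measureReal_empty]
      rw [hzP]
      unfold boxBias; rw [if_neg he]; ring
  rw [hA, ← real_setOf_toCube N p P, ← real_setOf_toCube N p Q, ← real_inter_setOf_toCube N p P Q] at h
  exact h

include hP hQ in
/-- **THE PIVOTAL SANDWICH OF THE HARRIS SLACK** (every `d`, `N`, `p`; increasing cube events `A`, `B`; `I_z(·) = P_p(z ∈ E(ℤ^d), z piv ·)`,
`W = p(1−p)Σ_z I_z(A)I_z(B)`): **`W/(40·log²(max(e², 1/(4W)))) ≤ P_p(A ∩ B) − P_p(A)P_p(B) ≤ p(1−p)·Σ_z √(I_z(A)·I_z(B))`** — two increasing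
events are positively correlated EXACTLY to the extent that they share pivotal edges: the slack is squeezed between the `ℓ¹` joint pivotal
weight (up to `log²`) and the `ℓ^{1/2}` one (gen 23's `lattice_abs_cov_le_pivotal`).  In particular `Cov = 0 ⟺ W = 0 ⟺ no edge is pivotal for
both with positive probability`. [cite: Talagrand1996, Thm 1.1 and §1] [cite: DeNadimpalliServedio2021, Thm 41] -/
theorem lattice_cov_pivotal_sandwich :
    ((p : ℝ) * (1 - p) * ∑ z ∈ (box d N).sym2,
          (bondPercolation (zdGraph d) p).real {ω | z ∈ (zdGraph d).edgeSet ∧ IsPivotal {ω | P (toCube N ω)} z ω}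
            * (bondPercolation (zdGraph d) p).real {ω | z ∈ (zdGraph d).edgeSet ∧ IsPivotal {ω | Q (toCube N ω)} z ω})
        / (40 * Real.log (max (Real.exp 2) (1 / 4 / ((p : ℝ) * (1 - p) * ∑ z ∈ (box d N).sym2,
          (bondPercolation (zdGraph d) p).real {ω | z ∈ (zdGraph d).edgeSet ∧ IsPivotal {ω | P (toCube N ω)} z ω}
            * (bondPercolation (zdGraph d) p).real {ω | z ∈ (zdGraph d).edgeSet ∧ IsPivotal {ω | Q (toCube N ω)} z ω}))) ^ 2)
      ≤ (bondPercolation (zdGraph d) p).real ({ω | P (toCube N ω)} ∩ {ω | Q (toCube N ω)})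
        - (bondPercolation (zdGraph d) p).real {ω | P (toCube N ω)} * (bondPercolation (zdGraph d) p).real {ω | Q (toCube N ω)}
    ∧ (bondPercolation (zdGraph d) p).real ({ω | P (toCube N ω)} ∩ {ω | Q (toCube N ω)})
        - (bondPercolation (zdGraph d) p).real {ω | P (toCube N ω)} * (bondPercolation (zdGraph d) p).real {ω | Q (toCube N ω)}
      ≤ (p : ℝ) * (1 - p) * ∑ z ∈ (box d N).sym2,
          Real.sqrt ((bondPercolation (zdGraph d) p).real {ω | z ∈ (zdGraph d).edgeSet ∧ IsPivotal {ω | P (toCube N ω)} z ω})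
            * Real.sqrt ((bondPercolation (zdGraph d) p).real {ω | z ∈ (zdGraph d).edgeSet ∧ IsPivotal {ω | Q (toCube N ω)} z ω}) :=
  ⟨lattice_cov_ge_level_one_div_log_sq N p P Q hP hQ, (le_abs_self _).trans (lattice_abs_cov_le_pivotal N p P Q hP hQ)⟩

end Lattice

/-! ## §2 Kesten's box crossings in two directions -/

section BoxCross

variable (L : Site d) (N : ℕ) (hLN : Finset.Icc (0 : Site d) L ⊆ box d N) (p : unitInterval)

open Classical in
include hLN in
/-- **TWO CROSSING DIRECTIONS** (every `d`, `{0..L} ⊆ Λ(N)`, every `p`; `A = boxCross L i`, `B = boxCross L j`,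
`W = p(1−p)·Σ_{z ⊆ Λ(N)} P_p(z ∈ E(ℤ^d), z piv A)·P_p(z ∈ E(ℤ^d), z piv B)`):
**`W / (40·log²(max(e², 1/(4W)))) ≤ P_p(A ∩ B) − P_p(A)·P_p(B)`** — with gen 23's `boxCross_abs_cov_le_pivotal` the correlation of two crossing
directions is pinned by their common pivotal edges from both sides. [cite: DeNadimpalliServedio2021, Thm 41] [cite: Kesten1982, §3.3] -/
theorem boxCross_cov_ge_level_one_div_log_sq (i j : Fin d) :
    ((p : ℝ) * (1 - p) * ∑ z ∈ (box d N).sym2,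
          (bondPercolation (zdGraph d) p).real {ω | z ∈ (zdGraph d).edgeSet ∧ IsPivotal (boxCross L i) z ω}
            * (bondPercolation (zdGraph d) p).real {ω | z ∈ (zdGraph d).edgeSet ∧ IsPivotal (boxCross L j) z ω})
        / (40 * Real.log (max (Real.exp 2) (1 / 4 / ((p : ℝ) * (1 - p) * ∑ z ∈ (box d N).sym2,
          (bondPercolation (zdGraph d) p).real {ω | z ∈ (zdGraph d).edgeSet ∧ IsPivotal (boxCross L i) z ω}
            * (bondPercolation (zdGraph d) p).real {ω | z ∈ (zdGraph d).edgeSet ∧ IsPivotal (boxCross L j) z ω}))) ^ 2)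
      ≤ (bondPercolation (zdGraph d) p).real (boxCross L i ∩ boxCross L j)
        - (bondPercolation (zdGraph d) p).real (boxCross L i) * (bondPercolation (zdGraph d) p).real (boxCross L j) := by
  have h := lattice_cov_ge_level_one_div_log_sq N p
    (fun x => SConn (fun a b : BoxV d N => if a.1 ∈ Icc 0 L ∧ b.1 ∈ Icc 0 L then latEdge d N a b else none)
        {v : BoxV d N | v.1 ∈ Icc 0 L ∧ v.1 i = 0} {v : BoxV d N | v.1 ∈ Icc 0 L ∧ v.1 i = L i} x)
    (fun x => SConn (fun a b : BoxV d N => if a.1 ∈ Icc 0 L ∧ b.1 ∈ Icc 0 L then latEdge d N a b else none)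
        {v : BoxV d N | v.1 ∈ Icc 0 L ∧ v.1 j = 0} {v : BoxV d N | v.1 ∈ Icc 0 L ∧ v.1 j = L j} x)
    (fun e x hx => sconn_block_mono L N (fun e' he' => by
      by_cases hee : e' = e
      · subst hee; simp
      · rwa [update_of_ne hee] at he' ⊢) hx)
    (fun e x hx => sconn_block_mono L N (fun e' he' => by
      by_cases hee : e' = e
      · subst hee; simp
      · rwa [update_of_ne hee] at he' ⊢) hx)
  rw [real_inter_setOf_sconn_hyperplanes_eq L N hLN p i j, real_setOf_sconn_hyperplanes_eq L N hLN p i,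
    real_setOf_sconn_hyperplanes_eq L N hLN p j] at h
  simp only [real_isPivotal_setOf_sconn_hyperplanes_eq L N hLN p] at h
  exact h

end BoxCross

end Summit.CriticalPhenomena.PercolationContinuityZ3.Theorems.Crossing

end
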